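import Mathlib
import HarnessLib
import Literature.Probability.MarkovChains.AbelConvergence
import Literature.Probability.MarkovChains.AbelCesaroConvergence
import Literature.Probability.MarkovChains.DoeblinIteratedKernel

/-!
# `lim_n (A_n)_{ij} = π_{ij}`: the Cesàro limits of a finite chain are `π_{jj} = 1/E[ρ_j | X_0 = j]` and `π_{ij} = P(ρ_j < ∞ | X_0 = i)π_{jj}` (Stroock 2014, (4.1.11)–(4.1.12), Lemma 4.1.13)

HONEST FRAMING: exact (Metropolis-corrected) sampling algorithms for lattice gauge theory; figures
of merit are autocorrelation/cost numbers at stated couplings and volumes; no continuum-physics claim.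

SOURCE (read on the hub's materialised pages): D. W. Stroock, *An Introduction to Markov Processes*,
2nd ed., GTM **230**, Springer 2014 [Stroock2014], §4.1.5 "A Small Improvement": **(4.1.11)**
`lim_{n→∞} (A_n)_{ij} = π_{ij}`, `A_n = n⁻¹ Σ_{m=0}^{n−1} Pᵐ`, with `π_{ij}` the Abel limits of
(4.1.5); the "easy estimate" **(4.1.12)** `{a_m} ⊆ [0,1], A_n = n⁻¹Σ_0^{n−1} a_ℓ ⟹ |A_n − A_{n−m}|
≤ m/n (0 ≤ m < n)`; and the renewal identity of LEMMA 4.1.13's proof,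
`(A_n)_{ij} = Σ_{m=1}^{n−1} f(m)_{ij}(1 − m/n)(A_{n−m})_{jj}` for `i ≠ j`.

SETTING AND DECLARED ROUTE: finite state space (`Matrix X X ℝ`, `A_n = powAvg P n` of
`DoeblinCesaroAverages.lean`).  The book derives (4.1.11) from (4.1.5) by its own Tauberian step
(Lemma 4.1.13 + Theorem 4.1.10).  For a FINITE chain the tree already knows that the Cesàro means
converge — Levin–Peres–Wilmer PROPOSITION 1.32 (`CesaroLimitStationary.lean`,
`LevinPeres2017_prop_1_32`: `v_T = T⁻¹Σ_{t<T} vPᵗ → π_v` for every probability vector `v`) — so here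
(4.1.11) is obtained by the ABELIAN direction instead: a convergent Cesàro sequence is Abel
convergent to the same limit (EXERCISE 4.2.1 (a), `AbelCesaroConvergence.lean`), and the Abel limit
is `π_{ij}` by (4.1.5) (`AbelConvergence.lean`); limits along `s ↗ 1` are unique.  The identity of
Lemma 4.1.13 and (4.1.12) are proved as printed (the first is the tree's summed renewal equation
`sum_pow_apply_eq_triangle` divided by `n`).

* `exists_tendsto_powAvg_apply` — `(A_n)_{ij}` converges (LPW Prop. 1.32 read entrywise);
* `tendsto_abelResolvent_of_tendsto_powAvg` — its limit is the Abel limit of `(Pⁿ)_{ij}`;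
* **(4.1.11)** `Stroock2014_eq_4_1_11_transient` (`P(ρ_j = ∞ | X_0 = j) > 0 ⟹ (A_n)_{ij} → 0` for
  all `i`), `Stroock2014_eq_4_1_11_posRecurrent` (`j` recurrent, `Σ_m m f(m)_{jj} = E ⟹
  (A_n)_{jj} → E⁻¹`), `Stroock2014_eq_4_1_11_offDiag` (`(A_n)_{ij} → P(ρ_j < ∞ | X_0 = i)·E⁻¹`,
  `i ≠ j`), `Stroock2014_eq_4_1_11_nullRecurrent` (the formal case);
* **(4.1.12)** `Stroock2014_eq_4_1_12`;
* LEMMA 4.1.13's identity `Stroock2014_lemma_4_1_13_identity`.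

Everything is PROVED (0 named facts).  Not here: Lemma 4.1.13's limsup bound `≤ eπ_{jj}` and its
subsequence statement, Theorem 4.1.14, §4.1.7.
-/

namespace Literature.Probability.MarkovChains

open Finset Matrix Filter Topology

variable {X : Type*} [Fintype X] [DecidableEq X]

/-! ## The Cesàro means of a finite chain converge, and their limit is the Abel limit -/

/-- **`(A_n)_{ij}` converges** for every finite transition probability matrix (Levin–Peres–Wilmer
Prop. 1.32 for the start `δ_i`, read at the coordinate `j`). [cite: LevinPeres2017, §1.8 Prop. 1.32];
[cite: Stroock2014, §4.1.5 eq. (4.1.11)] -/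
theorem exists_tendsto_powAvg_apply {P : Matrix X X ℝ} (hP : IsRowStochastic P) (i j : X) :
    ∃ L : ℝ, Tendsto (fun n => powAvg P n i j) atTop (𝓝 L) := by
  obtain ⟨π, -, -, -, hconv⟩ := LevinPeres2017_prop_1_32 hP (v := Pi.single i 1)
    (fun x => by rw [Pi.single_apply]; split_ifs <;> norm_num) (by simp)
  refine ⟨π j, ?_⟩
  have h := (continuous_apply j).continuousAt.tendsto.comp hconv
  refine h.congr fun n => ?_
  simp only [Function.comp_apply]
  rw [← vecMul_powAvg_eq_cesaroMean, vecMul, dotProduct]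
  simp_rw [Pi.single_apply]
  simp

/-- **The Cesàro limit is the Abel limit**: if `(A_n)_{ij} → L` then `R(s)_{ij} → L` as `s ↗ 1`
(Exercise 4.2.1 (a) with `a_n = (Pⁿ)_{ij} ∈ [0,1]`, whose radius of convergence is `≥ 1`).
[cite: Stroock2014, §4.2 Exercise 4.2.1 (a); §4.1.5 (4.1.11)] -/
theorem tendsto_abelResolvent_of_tendsto_powAvg {P : Matrix X X ℝ} (hP : IsRowStochastic P)
    {i j : X} {L : ℝ} (hL : Tendsto (fun n => powAvg P n i j) atTop (𝓝 L)) :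
    Tendsto (fun s => abelResolvent P s i j) (𝓝[<] 1) (𝓝 L) := by
  have ha : ∀ r : ℝ, 1 < r → ∃ C : ℝ, ∀ n : ℕ, |(P ^ n) i j| ≤ C * r ^ n := fun r hr =>
    ⟨1, fun n => by
      rw [abs_of_nonneg ((hP.matPow n).1 i j), one_mul]
      exact ((hP.matPow n).1 i j |> fun _ => (single_le_sum (f := fun k => (P ^ n) i k)
        (fun k _ => (hP.matPow n).1 i k) (mem_univ j)).trans_eq ((hP.matPow n).2 i)).trans
        (one_le_pow₀ hr.le)⟩
  have hA : Tendsto (fun n : ℕ => (∑ m ∈ range n, (P ^ m) i j) / n) atTop (𝓝 L) := by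
    refine hL.congr fun n => ?_
    rw [powAvg_apply, div_eq_inv_mul]
  exact Stroock2014_ex_4_2_1_a ha hA

/-! ## (4.1.11) -/

/-- **(4.1.11), transient case**: if `P(ρ_j = ∞ | X_0 = j) > 0` then `(A_n)_{ij} → 0 = π_{ij}`
for every `i`. [cite: Stroock2014, §4.1.5 eq. (4.1.11) (with (4.1.5): `π_{jj} = 0` for a transient
`j`)] -/
theorem Stroock2014_eq_4_1_11_transient {P : Matrix X X ℝ} (hP : IsRowStochastic P) {j : X}
    (hj : 0 < noReturnProb P j j) (i : X) :
    Tendsto (fun n => powAvg P n i j) atTop (𝓝 0) := by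
  obtain ⟨L, hL⟩ := exists_tendsto_powAvg_apply hP i j
  have habel := tendsto_abelResolvent_of_tendsto_powAvg hP hL
  have hjj := Stroock2014_eq_4_1_5_transient hP hj
  have hlim : Tendsto (fun s => abelResolvent P s i j) (𝓝[<] 1) (𝓝 0) := by
    by_cases hij : i = j
    · subst hij; exact hjj
    · have := Stroock2014_eq_4_1_5_offDiag hP hij hjj
      rwa [mul_zero] at this
  rwa [tendsto_nhds_unique habel hlim] at hL

/-- **(4.1.11), positive recurrent diagonal case**: if `j` is recurrent (`P(ρ_j = ∞ | X_0 = j) = 0`)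
with `E[ρ_j | X_0 = j] = Σ_m m f(m)_{jj} = E`, then `(A_n)_{jj} → E⁻¹ = π_{jj}`.
[cite: Stroock2014, §4.1.5 eq. (4.1.11) (with (4.1.5): `π_{jj} = (E[ρ_j | X_0 = j])⁻¹`)] -/
theorem Stroock2014_eq_4_1_11_posRecurrent {P : Matrix X X ℝ} (hP : IsRowStochastic P) {j : X}
    (hj : noReturnProb P j j = 0) {E : ℝ}
    (hE : HasSum (fun m : ℕ => (m : ℝ) * firstPassageProb P j m j) E) :
    Tendsto (fun n => powAvg P n j j) atTop (𝓝 E⁻¹) := by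
  obtain ⟨L, hL⟩ := exists_tendsto_powAvg_apply hP j j
  have habel := tendsto_abelResolvent_of_tendsto_powAvg hP hL
  rwa [tendsto_nhds_unique habel (Stroock2014_eq_4_1_5_posRecurrent hP hj hE)] at hL

/-- **(4.1.11), off-diagonal entries for a positive recurrent `j`**:
`(A_n)_{ij} → P(ρ_j < ∞ | X_0 = i)·E⁻¹ = π_{ij}` (`i ≠ j`). [cite: Stroock2014, §4.1.5 eq. (4.1.11)
(with (4.1.5): `π_{ij} = P(ρ_j < ∞ | X_0 = i)π_{jj}`)] -/
theorem Stroock2014_eq_4_1_11_offDiag {P : Matrix X X ℝ} (hP : IsRowStochastic P) {i j : X}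
    (hij : i ≠ j) (hj : noReturnProb P j j = 0) {E : ℝ}
    (hE : HasSum (fun m : ℕ => (m : ℝ) * firstPassageProb P j m j) E) :
    Tendsto (fun n => powAvg P n i j) atTop (𝓝 ((1 - noReturnProb P j i) * E⁻¹)) := by
  obtain ⟨L, hL⟩ := exists_tendsto_powAvg_apply hP i j
  have habel := tendsto_abelResolvent_of_tendsto_powAvg hP hL
  rwa [tendsto_nhds_unique habel
    (Stroock2014_eq_4_1_5_offDiag hP hij (Stroock2014_eq_4_1_5_posRecurrent hP hj hE))] at hL

/-- **(4.1.11), the formal null-recurrent case**: `j` recurrent with `Σ_m m f(m)_{jj} = ∞` gives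
`(A_n)_{ij} → 0` for all `i` (vacuous for finite chains; part of the printed dichotomy).
[cite: Stroock2014, §4.1.5 eq. (4.1.11)] -/
theorem Stroock2014_eq_4_1_11_nullRecurrent {P : Matrix X X ℝ} (hP : IsRowStochastic P) {j : X}
    (hj : noReturnProb P j j = 0)
    (hE : ¬ Summable fun m : ℕ => (m : ℝ) * firstPassageProb P j m j) (i : X) :
    Tendsto (fun n => powAvg P n i j) atTop (𝓝 0) := by
  obtain ⟨L, hL⟩ := exists_tendsto_powAvg_apply hP i j
  have habel := tendsto_abelResolvent_of_tendsto_powAvg hP hL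
  have hjj := Stroock2014_eq_4_1_5_nullRecurrent hP hj hE
  have hlim : Tendsto (fun s => abelResolvent P s i j) (𝓝[<] 1) (𝓝 0) := by
    by_cases hij : i = j
    · subst hij; exact hjj
    · have := Stroock2014_eq_4_1_5_offDiag hP hij hjj
      rwa [mul_zero] at this
  rwa [tendsto_nhds_unique habel hlim] at hL

/-! ## (4.1.12) and the renewal identity of Lemma 4.1.13 -/

/-- **(4.1.12), the easy estimate**: for `{a_m} ⊆ [0,1]` and `A_n = n⁻¹ Σ_{ℓ<n} a_ℓ`,
`|A_n − A_{n−m}| ≤ m/n` for `0 ≤ m < n` ("`A_n − A_{n−m} = n⁻¹ Σ_{ℓ=n−m}^{n−1} a_ℓ −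
m/(n(n−m)) Σ_{ℓ<n−m} a_ℓ`, each of the two terms lying in `[0, m/n]`"). [cite: Stroock2014, §4.1.5
eq. (4.1.12)] -/
theorem Stroock2014_eq_4_1_12 {a : ℕ → ℝ} (ha0 : ∀ m, 0 ≤ a m) (ha1 : ∀ m, a m ≤ 1) {m n : ℕ}
    (hmn : m < n) :
    |(∑ l ∈ range n, a l) / n - (∑ l ∈ range (n - m), a l) / ((n - m : ℕ) : ℝ)| ≤ (m : ℝ) / n := by
  have hn : (0 : ℝ) < n := by exact_mod_cast (Nat.zero_le m).trans_lt hmn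
  have hnm : (0 : ℝ) < ((n - m : ℕ) : ℝ) := by exact_mod_cast Nat.sub_pos_of_lt hmn
  have hcast : ((n - m : ℕ) : ℝ) = n - m := by push_cast [Nat.cast_sub hmn.le]; ring
  -- split `Σ_{ℓ<n} = Σ_{ℓ<n−m} + Σ_{n−m≤ℓ<n}`
  set S : ℝ := ∑ l ∈ range (n - m), a l with hS
  set T : ℝ := ∑ l ∈ Ico (n - m) n, a l with hT
  have hsplit : ∑ l ∈ range n, a l = S + T := by
    rw [hS, hT, ← sum_range_add_sum_Ico _ (Nat.sub_le n m)]
  have hS0 : 0 ≤ S := sum_nonneg fun l _ => ha0 l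
  have hS1 : S ≤ ((n - m : ℕ) : ℝ) := by
    calc S ≤ ∑ l ∈ range (n - m), (1 : ℝ) := sum_le_sum fun l _ => ha1 l
      _ = ((n - m : ℕ) : ℝ) := by simp
  have hT0 : 0 ≤ T := sum_nonneg fun l _ => ha0 l
  have hT1 : T ≤ m := by
    calc T ≤ ∑ l ∈ Ico (n - m) n, (1 : ℝ) := sum_le_sum fun l _ => ha1 l
      _ = m := by rw [sum_const, Nat.card_Ico, show n - (n - m) = m by omega]; simp
  rw [hsplit]
  -- `(S+T)/n − S/(n−m) = T/n − m S/(n(n−m))`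
  have hid : (S + T) / n - S / ((n - m : ℕ) : ℝ) =
      T / n - (m : ℝ) * S / (n * ((n - m : ℕ) : ℝ)) := by
    rw [hcast] at hnm ⊢
    field_simp
    ring
  rw [hid, abs_le]
  constructor
  · -- `≥ −m/n`: `T/n ≥ 0` and `m S/(n(n−m)) ≤ m/n`
    have h2 : (m : ℝ) * S / (n * ((n - m : ℕ) : ℝ)) ≤ (m : ℝ) / n := by
      rw [div_le_div_iff₀ (mul_pos hn hnm) hn]
      calc (m : ℝ) * S * n ≤ (m : ℝ) * ((n - m : ℕ) : ℝ) * n := by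
            exact mul_le_mul_of_nonneg_right (mul_le_mul_of_nonneg_left hS1 (Nat.cast_nonneg m))
              hn.le
        _ = (m : ℝ) * (n * ((n - m : ℕ) : ℝ)) := by ring
    have h1 : 0 ≤ T / n := div_nonneg hT0 hn.le
    linarith
  · -- `≤ m/n`: `T/n ≤ m/n` and the subtracted term is `≥ 0`
    have h1 : T / n ≤ (m : ℝ) / n := div_le_div_of_nonneg_right hT1 hn.le
    have h2 : 0 ≤ (m : ℝ) * S / (n * ((n - m : ℕ) : ℝ)) :=
      div_nonneg (mul_nonneg (Nat.cast_nonneg m) hS0) (mul_pos hn hnm).le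
    linarith

/-- **The renewal identity for `A_n` (proof of Lemma 4.1.13)**: for `i ≠ j` and `n ≥ 1`,
`(A_n)_{ij} = Σ_{m=1}^{n−1} f(m)_{ij}(1 − m/n)(A_{n−m})_{jj}` (from (4.1.6); written over
`m − 1 ∈ {0,…,n−2}`). [cite: Stroock2014, §4.1.5 Lemma 4.1.13 (proof, "use (4.1.6) to arrive
at")] -/
theorem Stroock2014_lemma_4_1_13_identity {P : Matrix X X ℝ} (hP : IsRowStochastic P) {i j : X}
    (hij : i ≠ j) {n : ℕ} (hn : n ≠ 0) :
    powAvg P n i j = ∑ m ∈ range (n - 1), firstPassageProb P j (m + 1) i *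
      ((1 - ((m : ℝ) + 1) / n) * powAvg P (n - (m + 1)) j j) := by
  obtain ⟨N, rfl⟩ := Nat.exists_eq_succ_of_ne_zero hn
  rw [powAvg_apply, sum_pow_apply_eq_triangle hP j i N, if_neg hij, zero_add, Nat.succ_sub_one,
    mul_sum]
  refine sum_congr rfl fun m hm => ?_
  have hmN : m < N := mem_range.mp hm
  rw [powAvg_apply, show N + 1 - (m + 1) = N - m by omega]
  have hNm : ((N - m : ℕ) : ℝ) = N - m := by push_cast [Nat.cast_sub hmN.le]; ring
  have hN1 : (N : ℝ) + 1 ≠ 0 := by positivity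
  have hNm0 : (N : ℝ) - m ≠ 0 := sub_ne_zero.mpr (by exact_mod_cast hmN.ne')
  have hfac : (1 - ((m : ℝ) + 1) / ((N + 1 : ℕ) : ℝ)) * ((N - m : ℕ) : ℝ)⁻¹ = ((N + 1 : ℕ) : ℝ)⁻¹ := by
    rw [hNm]; push_cast; field_simp; ring
  calc ((N + 1 : ℕ) : ℝ)⁻¹ * (firstPassageProb P j (m + 1) i * ∑ r ∈ range (N - m), (P ^ r) j j)
      = firstPassageProb P j (m + 1) i *
          (((1 - ((m : ℝ) + 1) / ((N + 1 : ℕ) : ℝ)) * ((N - m : ℕ) : ℝ)⁻¹) *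
            ∑ r ∈ range (N - m), (P ^ r) j j) := by rw [hfac]; ring
    _ = _ := by push_cast; ring

end Literature.Probability.MarkovChains
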